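import Summits.Ventures.YMGap.FlowData.RectTubeKernelTaylorTwo
import Mathlib.Analysis.SpecialFunctions.Log.Deriv
import HarnessLib

/-!
# Venture YMGap, track Y3 FLOW-DATA — third-order Taylor data of the (twisted) rectangular-tube slice kernel
# `K_ζ(a,b) = ∫ exp(J Φ_ζ(a,E,b)) dE` and the real-arithmetic core of the THIRD-order law of `ln λ₀` (theorems only)

HONEST FRAMING: venture file of the cell `pub-ymgap` (QuantumFields programme), track Y3 (FLOW-DATA); companion THEOREMS for
`FlowData/RectTubeKernelTaylorTwo.lean` (second-order Taylor data `φ₁ = ∫_E Φ_ζ`, `φ₂ = ∫_E Φ_ζ²` of the twisted slice kernel and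
the real-arithmetic heart of the second-order law).  Finite rectangular tube `Π ℤ/Lᵢ`, compact `G`, continuous unitary `ρ`, ANY
plaquette field `ζ`; one-step exponent `Φ_ζ(a, E, b) = ½ magTw_ζ(a) + ½ magTw_ζ(b) + elec(a, E, b)`, `|Φ_ζ| ≤ c := n(3#P + N)`:

* `abs_exp_sub_cubic_le`, `abs_log_one_add_sub_cubic_le` — the elementary remainders `|eˣ − 1 − x − x²/2 − x³/6| ≤ |x|⁴`
  (`|x| ≤ 1`) and `|log(1+x) − (x − x²/2 + x³/3)| ≤ (4/3)|x|⁴` (`|x| ≤ ¼`), read off Mathlib's `Real.exp_bound` /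
  `Real.abs_log_sub_add_sum_range_le`;
* `abs_rectSliceKernelTw_taylor_three_le` — `|K_ζ(a,b) − 1 − J φ₁ − (J²/2) φ₂ − (J³/6) φ₃| ≤ (|J| c)⁴` with `φ₃ = ∫_E Φ_ζ³`,
  `|J| c ≤ 1`;
* `abs_approximant_sub_thirdOrder_le`, `abs_log_sub_cubicPoly_le`, **`abs_log_sub_thirdOrder_le`** — the real-arithmetic heart of
  the law `ln λ₀ = J m₁ + (J²/2)(m₂ − m₁²) + J² V + J³ (m₃/6 − m₁m₂/2 + m₁³/3 + V′ − 2 m₁ V + W) + O(u⁴)` (`u = |J| c ≤ 1/8`),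
  from the third-order data of the mean `t`, the row variance `v`, the new scalar `κ = ⟪w, T w⟫` and
  `‖T‖ = t + (2 − t) v + κ + O(u⁴)` (`FlowData/RankOneThirdOrder.lean`).

Used by the third-order law files of the chain (`RectTubeLogNormThirdOrder`).  Nothing about `L → ∞`, the continuum or a mass gap;
no FLOW-TABLE number.

References: I. Montvay, G. Münster (1994) §3.2.6 [cite: MontvayMunster1994, §3.2.6]; T. Kato (1966) §II.2 [cite: Kato1966, §II.2].
-/

noncomputable section

open scoped BigOperators ENNReal InnerProductSpace
open MeasureTheory Filter Function Topology Finset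
open Literature.MathematicalPhysics.QuantumFieldTheory Literature.Analysis.OperatorTheory
open Literature.MathematicalPhysics.QuantumLattice (RectTorusSite)
open Literature.Barriers.QuantumFields
open Summit.Ventures.YMGap.Census (RectPlaquette)

namespace Summit.Ventures.YMGap.FlowData

/-! ### Elementary fourth-order remainders -/

section Elementary

/-- `|eˣ − 1 − x − x²/2 − x³/6| ≤ |x|⁴` for `|x| ≤ 1` (Mathlib's `Real.exp_bound` with `n = 4`: the constant is `5/96`). [folklore] -/
theorem abs_exp_sub_cubic_le {x : ℝ} (hx : |x| ≤ 1) :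
    |Real.exp x - 1 - x - x ^ 2 / 2 - x ^ 3 / 6| ≤ |x| ^ 4 := by
  have h := Real.exp_bound hx (n := 4) (by norm_num)
  have hs : ∑ m ∈ range 4, x ^ m / (m.factorial : ℝ) = 1 + x + x ^ 2 / 2 + x ^ 3 / 6 := by
    simp only [Finset.sum_range_succ, Finset.sum_range_zero, Nat.factorial]
    norm_num
  rw [hs] at h
  have e : Real.exp x - 1 - x - x ^ 2 / 2 - x ^ 3 / 6 = Real.exp x - (1 + x + x ^ 2 / 2 + x ^ 3 / 6) := by ring
  rw [e]
  refine h.trans ?_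
  have h4 : 0 ≤ |x| ^ 4 := by positivity
  have hc : ((Nat.succ 4 : ℕ) : ℝ) / ((Nat.factorial 4 : ℕ) * (4 : ℕ)) ≤ 1 := by norm_num [Nat.factorial]
  calc |x| ^ 4 * (((Nat.succ 4 : ℕ) : ℝ) / ((Nat.factorial 4 : ℕ) * (4 : ℕ))) ≤ |x| ^ 4 * 1 :=
        mul_le_mul_of_nonneg_left hc h4
    _ = |x| ^ 4 := mul_one _

/-- `|log(1 + x) − (x − x²/2 + x³/3)| ≤ (4/3)|x|⁴` for `|x| ≤ ¼` (Mathlib's logarithmic series with remainder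
`|x|⁴/(1 − |x|)`). [folklore] -/
theorem abs_log_one_add_sub_cubic_le {x : ℝ} (hx : |x| ≤ 1 / 4) :
    |Real.log (1 + x) - (x - x ^ 2 / 2 + x ^ 3 / 3)| ≤ 4 / 3 * |x| ^ 4 := by
  have hx1 : |(-x)| < 1 := by rw [abs_neg]; linarith
  have h := Real.abs_log_sub_add_sum_range_le hx1 3
  rw [abs_neg, sub_neg_eq_add] at h
  have hs : ∑ i ∈ range 3, (-x) ^ (i + 1) / ((i : ℝ) + 1) = -(x - x ^ 2 / 2 + x ^ 3 / 3) := by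
    simp only [Finset.sum_range_succ, Finset.sum_range_zero]
    norm_num
    ring
  rw [hs, add_comm, ← sub_eq_add_neg] at h
  refine h.trans ?_
  rw [div_le_iff₀ (by linarith)]
  have h4 : 0 ≤ |x| ^ 4 := by positivity
  nlinarith

end Elementary

/-! ### Third-order Taylor data of the twisted slice kernel -/

section KernelTaylor

variable {G : Type*} [Group G] [TopologicalSpace G] [IsTopologicalGroup G] [CompactSpace G]
  [MeasurableSpace G] [BorelSpace G] [SecondCountableTopology G] {n k : ℕ} (ρ : G →* Matrix (Fin n) (Fin n) ℂ)
  (J : ℝ) {Ls : Fin k → ℕ} [∀ i, NeZero (Ls i)]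

/-- **Third-order Taylor expansion of the twisted slice kernel**: for `|J| c ≤ 1`,
`|K_ζ(a,b) − 1 − J φ₁(a,b) − (J²/2) φ₂(a,b) − (J³/6) φ₃(a,b)| ≤ (|J| c)⁴` with `φ_j = ∫_E Φ_ζʲ`. [cite: Kato1966, §II.2] -/
theorem abs_rectSliceKernelTw_taylor_three_le (hρ : Continuous ρ) (hρu : ∀ g, ρ g ∈ Matrix.unitaryGroup (Fin n) ℂ)
    (ζ : RectPlaquette Ls → G)
    (hJ : |J| * (n * (3 * (Fintype.card (RectTorusSite Ls) * Fintype.card {p : Fin k × Fin k // p.1 < p.2}) +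
        Fintype.card (RectTorusSite Ls × Fin k))) ≤ 1) (a b : RectSlice Ls G) :
    |rectSliceKernelTw (Ls := Ls) ρ ζ J J a b - 1 -
        J * (∫ E, (rectMagSumTw ρ ζ a / 2 + rectMagSumTw ρ ζ b / 2 + rectElecSum ρ a E b)
          ∂(Measure.pi fun _ : RectTorusSite Ls => haarProbability G)) -
        J ^ 2 / 2 * (∫ E, (rectMagSumTw ρ ζ a / 2 + rectMagSumTw ρ ζ b / 2 + rectElecSum ρ a E b) ^ 2
          ∂(Measure.pi fun _ : RectTorusSite Ls => haarProbability G)) -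
        J ^ 3 / 6 * (∫ E, (rectMagSumTw ρ ζ a / 2 + rectMagSumTw ρ ζ b / 2 + rectElecSum ρ a E b) ^ 3
          ∂(Measure.pi fun _ : RectTorusSite Ls => haarProbability G))| ≤
      (|J| * (n * (3 * (Fintype.card (RectTorusSite Ls) * Fintype.card {p : Fin k × Fin k // p.1 < p.2}) +
        Fintype.card (RectTorusSite Ls × Fin k)))) ^ 4 := by
  set c : ℝ := n * (3 * (Fintype.card (RectTorusSite Ls) * Fintype.card {p : Fin k × Fin k // p.1 < p.2}) +
        Fintype.card (RectTorusSite Ls × Fin k)) with hc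
  set μE : Measure (RectTorusSite Ls → G) := Measure.pi fun _ : RectTorusSite Ls => haarProbability G with hμE
  set Φ : (RectTorusSite Ls → G) → ℝ := fun E => rectMagSumTw ρ ζ a / 2 + rectMagSumTw ρ ζ b / 2 + rectElecSum ρ a E b
    with hΦ
  have hΦb : ∀ E, |Φ E| ≤ c := fun E => abs_stepExponent_le ρ (Ls := Ls) hρu ζ a E b
  have hc0 : 0 ≤ c := by positivity
  -- continuity / integrability in `E`
  have hel : Continuous fun E : RectTorusSite Ls → G => rectElecSum ρ a E b := by
    have htr : Continuous fun g : G => (ρ g).trace.re := Complex.continuous_re.comp (Continuous.matrix_trace hρ)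
    unfold rectElecSum
    refine continuous_finsetSum _ fun x _ => continuous_finsetSum _ fun i _ => htr.comp ?_
    exact (((continuous_apply x).mul continuous_const).mul (continuous_apply (x + Pi.single i 1)).inv).mul
      continuous_const
  have hΦc : Continuous Φ := continuous_const.add hel
  have hint : ∀ {f : (RectTorusSite Ls → G) → ℝ}, Continuous f → Integrable f μE := fun hf =>
    hf.integrable_of_hasCompactSupport (HasCompactSupport.of_compactSpace _)
  have iexp : Integrable (fun E => Real.exp (J * Φ E)) μE := hint ((continuous_const.mul hΦc).rexp)
  have i1 : Integrable Φ μE := hint hΦc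
  have i2 : Integrable (fun E => Φ E ^ 2) μE := hint (hΦc.pow 2)
  have i3 : Integrable (fun E => Φ E ^ 3) μE := hint (hΦc.pow 3)
  -- pointwise Taylor
  have hpt : ∀ E, |Real.exp (J * Φ E) - 1 - J * Φ E - J ^ 2 / 2 * Φ E ^ 2 - J ^ 3 / 6 * Φ E ^ 3| ≤ (|J| * c) ^ 4 := by
    intro E
    have hx : |J * Φ E| ≤ |J| * c := by rw [abs_mul]; exact mul_le_mul_of_nonneg_left (hΦb E) (abs_nonneg _)
    have hx1 : |J * Φ E| ≤ 1 := hx.trans hJ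
    have h := abs_exp_sub_cubic_le hx1
    have h2 : Real.exp (J * Φ E) - 1 - J * Φ E - J ^ 2 / 2 * Φ E ^ 2 - J ^ 3 / 6 * Φ E ^ 3 =
        Real.exp (J * Φ E) - 1 - J * Φ E - (J * Φ E) ^ 2 / 2 - (J * Φ E) ^ 3 / 6 := by ring
    rw [h2]
    exact h.trans (pow_le_pow_left₀ (abs_nonneg _) hx 4)
  -- integrate
  rw [rectSliceKernelTw_eq_integral_exp]
  have heq : (∫ E, Real.exp (J * Φ E) ∂μE) - 1 - J * (∫ E, Φ E ∂μE) - J ^ 2 / 2 * (∫ E, Φ E ^ 2 ∂μE) -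
      J ^ 3 / 6 * (∫ E, Φ E ^ 3 ∂μE) =
      ∫ E, (Real.exp (J * Φ E) - 1 - J * Φ E - J ^ 2 / 2 * Φ E ^ 2 - J ^ 3 / 6 * Φ E ^ 3) ∂μE := by
    have i1J : Integrable (fun E => J * Φ E) μE := i1.const_mul J
    have i2J : Integrable (fun E => J ^ 2 / 2 * Φ E ^ 2) μE := i2.const_mul _
    have i3J : Integrable (fun E => J ^ 3 / 6 * Φ E ^ 3) μE := i3.const_mul _
    have ie1 : Integrable (fun E => Real.exp (J * Φ E) - 1) μE := iexp.sub (integrable_const _)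
    have ie1J : Integrable (fun E => Real.exp (J * Φ E) - 1 - J * Φ E) μE := ie1.sub i1J
    have ie2J : Integrable (fun E => Real.exp (J * Φ E) - 1 - J * Φ E - J ^ 2 / 2 * Φ E ^ 2) μE := ie1J.sub i2J
    rw [integral_sub ie2J i3J, integral_sub ie1J i2J, integral_sub ie1 i1J, integral_sub iexp (integrable_const _),
      integral_const_mul, integral_const_mul, integral_const_mul, integral_const, probReal_univ, one_smul]
  show |(∫ E, Real.exp (J * Φ E) ∂μE) - 1 - J * (∫ E, Φ E ∂μE) - J ^ 2 / 2 * (∫ E, Φ E ^ 2 ∂μE) -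
      J ^ 3 / 6 * (∫ E, Φ E ^ 3 ∂μE)| ≤ (|J| * c) ^ 4
  rw [heq]
  have h := norm_integral_le_of_norm_le_const (μ := μE)
    (f := fun E => Real.exp (J * Φ E) - 1 - J * Φ E - J ^ 2 / 2 * Φ E ^ 2 - J ^ 3 / 6 * Φ E ^ 3) (C := (|J| * c) ^ 4)
    (ae_of_all _ fun E => by rw [Real.norm_eq_abs]; exact hpt E)
  rwa [Real.norm_eq_abs, probReal_univ, mul_one] at h

end KernelTaylor

/-! ### The real-arithmetic heart of the third-order law -/

section RealArithmetic

set_option maxHeartbeats 400000 in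
/-- **Step 1**: from the third-order data of `t` (mean), `v` (row variance), `κ = ⟪w, T w⟫` and
`N = ‖T‖ ≈ t + (2 − t) v + κ`, the quantity `N − 1` equals `a₁ + a₂ + a₃` up to `60 u⁴`, where `a₁ = J m₁`,
`a₂ = (J²/2) m₂ + J² V`, `a₃ = (J³/6) m₃ + J³ V′ − J m₁ · J² V + J³ W` (`u ≤ 1/8`). [folklore] -/
theorem abs_approximant_sub_thirdOrder_le {u J m₁ m₂ m₃ V V' W t v κ N : ℝ} (hu0 : 0 ≤ u) (hu : u ≤ 1 / 8)
    (h1 : |J * m₁| ≤ u) (h2 : |J ^ 2 / 2 * m₂| ≤ u ^ 2 / 2) (h2b : |J ^ 3 / 6 * m₃| ≤ u ^ 3 / 6)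
    (h3 : 0 ≤ J ^ 2 * V) (h3' : J ^ 2 * V ≤ 4 * u ^ 2) (h3b : |J ^ 3 * V'| ≤ 4 * u ^ 3)
    (ht : |t - (1 + J * m₁ + J ^ 2 / 2 * m₂ + J ^ 3 / 6 * m₃)| ≤ u ^ 4)
    (hv : |v - (J ^ 2 * V + J ^ 3 * V')| ≤ 5 * u ^ 4) (hκ : |κ - J ^ 3 * W| ≤ 8 * u ^ 4)
    (hN : |N - (t + (2 - t) * v + κ)| ≤ 33 * u ^ 4) :
    |N - 1 - (J * m₁ + (J ^ 2 / 2 * m₂ + J ^ 2 * V) + (J ^ 3 / 6 * m₃ + J ^ 3 * V' - J * m₁ * (J ^ 2 * V) + J ^ 3 * W))| ≤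
      60 * u ^ 4 := by
  set A : ℝ := J * m₁ + J ^ 2 / 2 * m₂ + J ^ 3 / 6 * m₃ with hA
  set Rt : ℝ := t - (1 + A) with hRt
  set Rv : ℝ := v - (J ^ 2 * V + J ^ 3 * V') with hRv
  set Rκ : ℝ := κ - J ^ 3 * W with hRκ
  set RN : ℝ := N - (t + (2 - t) * v + κ) with hRN
  have hu2 : u ^ 2 ≤ 1 / 64 := by nlinarith
  have hu3 : u ^ 3 ≤ u ^ 2 / 8 := by nlinarith [mul_le_mul_of_nonneg_left hu (sq_nonneg u)]
  have hu4 : u ^ 4 ≤ u ^ 2 / 64 := by nlinarith [mul_le_mul hu2 hu2 (sq_nonneg u) (by norm_num)]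
  have hu4p : 0 ≤ u ^ 4 := pow_nonneg hu0 4
  have hu5 : u ^ 5 ≤ u ^ 4 / 8 := by nlinarith [mul_le_mul_of_nonneg_left hu hu4p]
  have hu6 : u ^ 6 ≤ u ^ 4 / 64 := by nlinarith [mul_le_mul_of_nonneg_left hu2 hu4p]
  have hu7 : u ^ 7 ≤ u ^ 4 / 512 := by
    nlinarith [mul_le_mul_of_nonneg_left hu3 hu4p, mul_le_mul_of_nonneg_left hu2 hu4p]
  have hRt' : |Rt| ≤ u ^ 4 := by
    have e : Rt = t - (1 + J * m₁ + J ^ 2 / 2 * m₂ + J ^ 3 / 6 * m₃) := by rw [hRt, hA]; ring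
    rw [e]; exact ht
  -- sizes
  have hAm : |A - J * m₁| ≤ u ^ 2 / 2 + u ^ 3 / 6 := by
    have e : A - J * m₁ = J ^ 2 / 2 * m₂ + J ^ 3 / 6 * m₃ := by rw [hA]; ring
    rw [e]
    exact (abs_add_le _ _).trans (add_le_add h2 h2b)
  have hAb : |A| ≤ 5 / 4 * u := by
    have e : A = J * m₁ + (A - J * m₁) := by ring
    rw [e]
    refine (abs_add_le _ _).trans ?_
    nlinarith [h1, hAm]
  have hone : |1 - A - Rt| ≤ 5 / 4 := by
    calc |1 - A - Rt| ≤ |1 - A| + |Rt| := abs_sub _ _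
      _ ≤ |(1:ℝ)| + |A| + |Rt| := add_le_add (abs_sub _ _) le_rfl
      _ ≤ 1 + 5 / 4 * u + u ^ 4 := by rw [abs_one]; linarith [hRt']
      _ ≤ 5 / 4 := by linarith [hu4, hu2]
  have hVV : |J ^ 2 * V + J ^ 3 * V'| ≤ 4 * u ^ 2 + 4 * u ^ 3 :=
    (abs_add_le _ _).trans (add_le_add (by rw [abs_of_nonneg h3]; exact h3') h3b)
  -- the identity
  have hid : N - 1 - (J * m₁ + (J ^ 2 / 2 * m₂ + J ^ 2 * V) +
      (J ^ 3 / 6 * m₃ + J ^ 3 * V' - J * m₁ * (J ^ 2 * V) + J ^ 3 * W)) =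
      RN + Rt + (1 - A - Rt) * Rv + Rκ - (A - J * m₁) * (J ^ 2 * V) - A * (J ^ 3 * V') -
        Rt * (J ^ 2 * V + J ^ 3 * V') := by
    rw [hRN, hRt, hRv, hRκ, hA]; ring
  rw [hid]
  -- the six products
  have p1 : |(1 - A - Rt) * Rv| ≤ 5 / 4 * (5 * u ^ 4) := by
    rw [abs_mul]; exact mul_le_mul hone hv (abs_nonneg _) (by norm_num)
  have p2 : |(A - J * m₁) * (J ^ 2 * V)| ≤ (u ^ 2 / 2 + u ^ 3 / 6) * (4 * u ^ 2) := by
    rw [abs_mul, abs_of_nonneg h3]; exact mul_le_mul hAm h3' h3 (by positivity)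
  have p3 : |A * (J ^ 3 * V')| ≤ 5 / 4 * u * (4 * u ^ 3) := by
    rw [abs_mul]; exact mul_le_mul hAb h3b (abs_nonneg _) (by positivity)
  have p4 : |Rt * (J ^ 2 * V + J ^ 3 * V')| ≤ u ^ 4 * (4 * u ^ 2 + 4 * u ^ 3) := by
    rw [abs_mul]; exact mul_le_mul hRt' hVV (abs_nonneg _) (by positivity)
  calc |RN + Rt + (1 - A - Rt) * Rv + Rκ - (A - J * m₁) * (J ^ 2 * V) - A * (J ^ 3 * V') -
        Rt * (J ^ 2 * V + J ^ 3 * V')|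
      ≤ |RN| + |Rt| + |(1 - A - Rt) * Rv| + |Rκ| + |(A - J * m₁) * (J ^ 2 * V)| + |A * (J ^ 3 * V')| +
        |Rt * (J ^ 2 * V + J ^ 3 * V')| := by
        refine (abs_sub _ _).trans (add_le_add ?_ le_rfl)
        refine (abs_sub _ _).trans (add_le_add ?_ le_rfl)
        refine (abs_sub _ _).trans (add_le_add ?_ le_rfl)
        refine (abs_add_le _ _).trans (add_le_add ?_ le_rfl)
        refine (abs_add_le _ _).trans (add_le_add ?_ le_rfl)
        exact abs_add_le _ _
    _ ≤ 33 * u ^ 4 + u ^ 4 + 5 / 4 * (5 * u ^ 4) + 8 * u ^ 4 + (u ^ 2 / 2 + u ^ 3 / 6) * (4 * u ^ 2) +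
        5 / 4 * u * (4 * u ^ 3) + u ^ 4 * (4 * u ^ 2 + 4 * u ^ 3) := by
        linarith [hN, hRt', p1, hκ, p2, p3, p4]
    _ ≤ 60 * u ^ 4 := by linarith [hu5, hu6, hu7, hu4p]

/-- **Step 2**: if `|N − 1 − (a₁ + a₂ + a₃)| ≤ 60 u⁴` with `|a₁| ≤ u`, `|a₂| ≤ 5u²`, `|a₃| ≤ 13u³` (`u ≤ 1/8`), then
`|log N − (a₁ + a₂ + a₃ − a₁²/2 − a₁ a₂ + a₁³/3)| ≤ 160 u⁴`. [folklore] -/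
theorem abs_log_sub_cubicPoly_le {u a₁ a₂ a₃ N : ℝ} (hu0 : 0 ≤ u) (hu : u ≤ 1 / 8) (h1 : |a₁| ≤ u)
    (h2 : |a₂| ≤ 5 * u ^ 2) (h3 : |a₃| ≤ 13 * u ^ 3) (hN : |N - 1 - (a₁ + a₂ + a₃)| ≤ 60 * u ^ 4) :
    |Real.log N - (a₁ + a₂ + a₃ - a₁ ^ 2 / 2 - a₁ * a₂ + a₁ ^ 3 / 3)| ≤ 160 * u ^ 4 := by
  set x : ℝ := N - 1 with hx
  have hu2p : 0 ≤ u ^ 2 := sq_nonneg u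
  have hu3p : 0 ≤ u ^ 3 := pow_nonneg hu0 3
  have hu4p : 0 ≤ u ^ 4 := pow_nonneg hu0 4
  have hu2 : u ^ 2 ≤ u / 8 := by nlinarith
  have hu3 : u ^ 3 ≤ u ^ 2 / 8 := by nlinarith [mul_le_mul_of_nonneg_left hu (sq_nonneg u)]
  have hu4 : u ^ 4 ≤ u ^ 3 / 8 := by nlinarith [mul_le_mul_of_nonneg_left hu (pow_nonneg hu0 3)]
  have hδ : |x - (a₁ + a₂ + a₃)| ≤ 60 * u ^ 4 := hN
  -- `|x − a₁ − a₂| ≤ 21 u³`, `|x − a₁| ≤ 8 u²`, `|x| ≤ 2u ≤ 1/4`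
  have hx12 : |x - a₁ - a₂| ≤ 21 * u ^ 3 := by
    have e : x - a₁ - a₂ = (x - (a₁ + a₂ + a₃)) + a₃ := by ring
    rw [e]
    refine (abs_add_le _ _).trans ?_
    linarith [hu4, hu3p]
  have hx1 : |x - a₁| ≤ 8 * u ^ 2 := by
    have e : x - a₁ = (x - a₁ - a₂) + a₂ := by ring
    rw [e]
    refine (abs_add_le _ _).trans ?_
    linarith [hu3, hu2p]
  have hxb : |x| ≤ 2 * u := by
    have e : x = (x - a₁) + a₁ := by ring
    rw [e]
    refine (abs_add_le _ _).trans ?_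
    linarith [hu2]
  have hx4 : |x| ≤ 1 / 4 := by linarith
  -- logarithm
  have hlog : |Real.log (1 + x) - (x - x ^ 2 / 2 + x ^ 3 / 3)| ≤ 4 / 3 * |x| ^ 4 := abs_log_one_add_sub_cubic_le hx4
  have hx4p : |x| ^ 4 ≤ (2 * u) ^ 4 := pow_le_pow_left₀ (abs_nonneg _) hxb 4
  -- quadratic: `x² − a₁² − 2 a₁ a₂ = (x − a₁)² + 2 a₁ (x − a₁ − a₂)`
  have hquad : |x ^ 2 - a₁ ^ 2 - 2 * (a₁ * a₂)| ≤ 64 * u ^ 4 + 2 * (u * (21 * u ^ 3)) := by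
    have e : x ^ 2 - a₁ ^ 2 - 2 * (a₁ * a₂) = (x - a₁) ^ 2 + 2 * (a₁ * (x - a₁ - a₂)) := by ring
    rw [e]
    refine (abs_add_le _ _).trans (add_le_add ?_ ?_)
    · rw [abs_pow]
      calc |x - a₁| ^ 2 ≤ (8 * u ^ 2) ^ 2 := pow_le_pow_left₀ (abs_nonneg _) hx1 2
        _ = 64 * u ^ 4 := by ring
    · rw [abs_mul, abs_two, abs_mul]
      exact mul_le_mul_of_nonneg_left (mul_le_mul h1 hx12 (abs_nonneg _) hu0) zero_le_two
  -- cubic: `x³ − a₁³ = (x − a₁)(x² + x a₁ + a₁²)`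
  have hcub : |x ^ 3 - a₁ ^ 3| ≤ 8 * u ^ 2 * (7 * u ^ 2) := by
    have e : x ^ 3 - a₁ ^ 3 = (x - a₁) * (x ^ 2 + x * a₁ + a₁ ^ 2) := by ring
    rw [e, abs_mul]
    refine mul_le_mul hx1 ?_ (abs_nonneg _) (by positivity)
    calc |x ^ 2 + x * a₁ + a₁ ^ 2| ≤ |x ^ 2| + |x * a₁| + |a₁ ^ 2| :=
          (abs_add_le _ _).trans (add_le_add (abs_add_le _ _) le_rfl)
      _ ≤ (2 * u) ^ 2 + 2 * u * u + u ^ 2 := by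
          rw [abs_pow, abs_mul, abs_pow]
          exact add_le_add (add_le_add (pow_le_pow_left₀ (abs_nonneg _) hxb 2)
            (mul_le_mul hxb h1 (abs_nonneg _) (by positivity))) (pow_le_pow_left₀ (abs_nonneg _) h1 2)
      _ = 7 * u ^ 2 := by ring
  -- assemble
  have hN1 : N = 1 + x := by rw [hx]; ring
  have e : Real.log N - (a₁ + a₂ + a₃ - a₁ ^ 2 / 2 - a₁ * a₂ + a₁ ^ 3 / 3) =
      (Real.log (1 + x) - (x - x ^ 2 / 2 + x ^ 3 / 3)) + (x - (a₁ + a₂ + a₃)) -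
        (x ^ 2 - a₁ ^ 2 - 2 * (a₁ * a₂)) / 2 + (x ^ 3 - a₁ ^ 3) / 3 := by
    rw [hN1]; ring
  rw [e]
  calc |(Real.log (1 + x) - (x - x ^ 2 / 2 + x ^ 3 / 3)) + (x - (a₁ + a₂ + a₃)) -
        (x ^ 2 - a₁ ^ 2 - 2 * (a₁ * a₂)) / 2 + (x ^ 3 - a₁ ^ 3) / 3|
      ≤ |Real.log (1 + x) - (x - x ^ 2 / 2 + x ^ 3 / 3)| + |x - (a₁ + a₂ + a₃)| +
        |(x ^ 2 - a₁ ^ 2 - 2 * (a₁ * a₂)) / 2| + |(x ^ 3 - a₁ ^ 3) / 3| := by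
        refine (abs_add_le _ _).trans (add_le_add ?_ le_rfl)
        exact (abs_sub _ _).trans (add_le_add (abs_add_le _ _) le_rfl)
    _ ≤ 4 / 3 * (2 * u) ^ 4 + 60 * u ^ 4 + (64 * u ^ 4 + 2 * (u * (21 * u ^ 3))) / 2 + 8 * u ^ 2 * (7 * u ^ 2) / 3 := by
        rw [abs_div, abs_div, abs_two, abs_of_pos (by norm_num : (0:ℝ) < 3)]
        have hq := div_le_div_of_nonneg_right hquad zero_le_two
        have hc := div_le_div_of_nonneg_right hcub (by norm_num : (0:ℝ) ≤ 3)
        linarith [hlog, hx4p, hδ, hq, hc]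
    _ ≤ 160 * u ^ 4 := by linarith [hu4p]

/-- **THE REAL-ARITHMETIC HEART OF THE THIRD-ORDER LAW.**  From the third-order data
`t ≈ 1 + J m₁ + (J²/2) m₂ + (J³/6) m₃`, `v ≈ J² V + J³ V′`, `κ ≈ J³ W`, `N ≈ t + (2 − t) v + κ` (remainders `u⁴`, `5u⁴`,
`8u⁴`, `33u⁴`; sizes `|J m₁| ≤ u`, `|J² m₂| ≤ u²`, `|J³ m₃| ≤ u³`, `0 ≤ J² V ≤ 4u²`, `|J³ V′|, |J³ W| ≤ 4u³`, `u ≤ 1/8`):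
`|log N − (J m₁ + (J²/2)(m₂ − m₁²) + J² V + J³ (m₃/6 − m₁ m₂/2 + m₁³/3 + V′ − 2 m₁ V + W))| ≤ 160 u⁴`. [folklore] -/
theorem abs_log_sub_thirdOrder_le {u J m₁ m₂ m₃ V V' W t v κ N : ℝ} (hu0 : 0 ≤ u) (hu : u ≤ 1 / 8)
    (h1 : |J * m₁| ≤ u) (h2 : |J ^ 2 / 2 * m₂| ≤ u ^ 2 / 2) (h2b : |J ^ 3 / 6 * m₃| ≤ u ^ 3 / 6)
    (h3 : 0 ≤ J ^ 2 * V) (h3' : J ^ 2 * V ≤ 4 * u ^ 2) (h3b : |J ^ 3 * V'| ≤ 4 * u ^ 3) (h3c : |J ^ 3 * W| ≤ 4 * u ^ 3)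
    (ht : |t - (1 + J * m₁ + J ^ 2 / 2 * m₂ + J ^ 3 / 6 * m₃)| ≤ u ^ 4)
    (hv : |v - (J ^ 2 * V + J ^ 3 * V')| ≤ 5 * u ^ 4) (hκ : |κ - J ^ 3 * W| ≤ 8 * u ^ 4)
    (hN : |N - (t + (2 - t) * v + κ)| ≤ 33 * u ^ 4) :
    |Real.log N - (J * m₁ + J ^ 2 / 2 * (m₂ - m₁ ^ 2) + J ^ 2 * V +
        J ^ 3 * (m₃ / 6 - m₁ * m₂ / 2 + m₁ ^ 3 / 3 + V' - 2 * m₁ * V + W))| ≤ 160 * u ^ 4 := by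
  have hS1 := abs_approximant_sub_thirdOrder_le hu0 hu h1 h2 h2b h3 h3' h3b ht hv hκ hN
  have ha2 : |J ^ 2 / 2 * m₂ + J ^ 2 * V| ≤ 5 * u ^ 2 := by
    refine (abs_add_le _ _).trans ?_
    rw [abs_of_nonneg h3]
    linarith [sq_nonneg u]
  have ha3 : |J ^ 3 / 6 * m₃ + J ^ 3 * V' - J * m₁ * (J ^ 2 * V) + J ^ 3 * W| ≤ 13 * u ^ 3 := by
    have hp : |J * m₁ * (J ^ 2 * V)| ≤ u * (4 * u ^ 2) := by
      rw [abs_mul, abs_of_nonneg h3]; exact mul_le_mul h1 h3' h3 hu0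
    calc |J ^ 3 / 6 * m₃ + J ^ 3 * V' - J * m₁ * (J ^ 2 * V) + J ^ 3 * W|
        ≤ |J ^ 3 / 6 * m₃| + |J ^ 3 * V'| + |J * m₁ * (J ^ 2 * V)| + |J ^ 3 * W| := by
          refine (abs_add_le _ _).trans (add_le_add ?_ le_rfl)
          exact (abs_sub _ _).trans (add_le_add (abs_add_le _ _) le_rfl)
      _ ≤ u ^ 3 / 6 + 4 * u ^ 3 + u * (4 * u ^ 2) + 4 * u ^ 3 := by linarith [h2b, h3b, hp, h3c]
      _ ≤ 13 * u ^ 3 := by linarith [pow_nonneg hu0 3]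
  have hS2 := abs_log_sub_cubicPoly_le hu0 hu h1 ha2 ha3 hS1
  have e : J * m₁ + J ^ 2 / 2 * (m₂ - m₁ ^ 2) + J ^ 2 * V +
      J ^ 3 * (m₃ / 6 - m₁ * m₂ / 2 + m₁ ^ 3 / 3 + V' - 2 * m₁ * V + W) =
      J * m₁ + (J ^ 2 / 2 * m₂ + J ^ 2 * V) + (J ^ 3 / 6 * m₃ + J ^ 3 * V' - J * m₁ * (J ^ 2 * V) + J ^ 3 * W) -
        (J * m₁) ^ 2 / 2 - J * m₁ * (J ^ 2 / 2 * m₂ + J ^ 2 * V) + (J * m₁) ^ 3 / 3 := by ring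
  rw [e]
  exact hS2

end RealArithmetic

end Summit.Ventures.YMGap.FlowData
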